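import Literature.MathematicalPhysics.QuantumFieldTheory.Balaban1983to89.B16Ineq17ZetaError
import Literature.MathematicalPhysics.QuantumFieldTheory.Balaban1983to89.B6RandomWalkL2Schur

/-!
# `Balaban1983to89.B16Ineq17MinimizerError` — [Balaban1989LargeFieldII] p. 357 (the steps behind (1.7)), continued:
# *«Replacing the minimizer in this form by the kᵗʰ minimizer defined on the whole lattice … we change the form by a
# quadratic form bounded by O(exp(−R_k))»* — the minimizer-replacement error `E_H` PROVED from block-`ℓ²` decay majorants
# (global block Schur bound + a quadratic-form perturbation identity), the first-order error `E_A` of *«Sect. B [13]»* by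
# the mean value theorem, and (1.7) ASSEMBLED from its three printed steps

statement-level skeleton of published theorems with citation tags; proofs where landed; nothing here is a claim about
the Yang–Mills mass gap.

Cell pub-ymgap, HUMAN RULING D-0062 (Track A full width), seat `pub-ymgap-dag-n12-b` (-b FIRST-MISSING-ESTIMATE of DAG
node N12 = [B15] Prop. 1; printed proof [Balaban1989LargeFieldII] pp. 357–359).  Sequel of `B16Ineq17ZetaError` (this
seat): there the `ζ₀ → 1` half `E_ζ` of r13's replacement letter `hER` (`B16Ineq17Assembly.ineq17_of_inputs`, HONEST SCOPE
(c)) was proved and the minimizer half `E_H` kept as a letter; here `E_H` is proved too.  T. Bałaban, CMP **122** (1989)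
355–392 [Balaban1989LargeFieldII] p. 357 [PDF 3] (text layer re-read 2026-08-25); block calculus of [Balaban1984PropagatorsII]
(2.52) p. 232, (2.61) p. 234, (2.140) p. 247 in p22's `ℓ²` form (`B6RandomWalkL2`, `B6RandomWalkL2Schur`).

THE PRINT (p. 357, verbatim): *«The leading term in the expansion is the quadratic form with the background field
identically equal to 1. Replacing the minimizer in this form by the kᵗʰ minimizer defined on the whole lattice, and the
function ζ₀ by the function identically equal to 1, we change the form by a quadratic form bounded by O(exp(−R_k)). Now
the leading quadratic form is equal to ⟨B′, Δ_kB′⟩ defined by (1.65), (1.66) [10].»*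

THE READING TYPED HERE (declared; as in `B16Ineq17ZetaError`).  At background `1` the form is the `ζ₀`-weighted sum of
squares `Σ_p ζ₀(p)|(T_Z B′)(p)|²`, `T_Z = ∂∘H_{1,k,Z}` the linearised curvature of the REGION minimizer; the whole-lattice
one is `T = ∂∘H_k`, and *«the leading quadratic form … ⟨B′, Δ_kB′⟩»* is `Σ_p |(TB′)(p)|² = ‖TB′‖²` ((1.66) [10]: `Δ_k` is
the form of the k-th minimizer).  The minimizer-replacement error is `E_H = Σ_p ζ₀(p)(|(T_ZB′)(p)|² − |(TB′)(p)|²)`;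
*«bounded by O(exp(−R_k))»* because `B′` lives on `Λ`, deep inside `Z`, where the two minimizers differ by an
exponentially small operator: the DIFFERENCE `T_Z − T` has, for inputs in the blocks `S′` of `Λ`, a block-`ℓ²` majorant
`≤ C_D·e^{−δR′}·e^{−δd(y,y′)}` (`R′` = the separation of `Λ` from `Zᶜ` in blocks; a [13]-type localisation input), while
`T`, `T_Z` have majorants `≤ C·e^{−δd}` ((2.140)-type).

WHAT IS PROVED (0 `sorry`, no `def`, no new `Prop`; axioms standard; BY NAME: this seat's `blockSchur`,
`l2n_sq_eq_sum_blockPiece_sq`, `ineq17_of_inputs_zeta`, p22's `sum_mul_le_l2n_mul_l2n`, `l2n_add_le`).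
§1 `l2n_apply_sq_le` ∕ `l2n_apply_le_of_exp` — the GLOBAL block Schur bound: hom block-`ℓ²` majorant `K ≥ 0`, row sums
   `Σ_{y′∈S′}K(y,y′) ≤ A` (all `y`), column sums `Σ_y K(y,y′) ≤ A′` (`y′ ∈ S′`), `supp u ⊂` blocks of `S′` ⇒ `‖Tu‖² ≤
   AA′‖u‖²`; with `K ≤ Ce^{−δd}` and the row∕column sums of `e^{−(δ/2)d}` bounded by ONE constant `c`: `‖Tu‖ ≤ C·c·‖u‖`.
§2 `abs_weightedSq_sub_le` — the perturbation identity for weighted sums of squares, `|w| ≤ 1`: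
   `|Σ w·a² − Σ w·b²| ≤ ‖a − b‖·(‖a‖ + ‖b‖)` (Cauchy–Schwarz).
§3 **`minimizerError_le`** — `|E_H| ≤ 2·C_D·C·c²·e^{−δR′}·‖u‖²`; `minimizerError_le_exp_Rk` — `≤ 2C_DCc²·e^{−R_k}‖u‖²`
   once `R_k ≤ δR′` (the printed `O(exp(−R_k))‖B′‖²`).
§4 **`ineq17_of_majorants`** — (1.7) ASSEMBLED: from the splitting `Q = Σ_pζ₀(p)|(T_ZB′)(p)|² + E_A` (background-`1` form of
   the region minimizer + the first-order error of the expansion in `A₀`, LETTER `|E_A| ≤ C₁M⁶R_kε_k‖B′‖²`), the three decay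
   majorants (`T`, `T_Z`, `T_Z − T` on `Λ`-inputs), `0 ≤ ζ₀ ≤ 1` with `1 − ζ₀` supported on blocks `S` separated from the
   blocks `S′ ⊇ supp B′` by `R` (`R_k ≤ δR`, `R_k ≤ δR′`), the half-rate row∕column sums `≤ c`, and (1.67) [10] in the form
   `γ₀‖∂B′‖² ≤ ‖TB′‖²`: r13's leaf `Ineq17 Q ‖∂B′‖² ‖B′‖² γ₀ (max C₁ (2C_DCc² + C²c²)) M R_k ε_k`.

§5 `firstOrderError_le` ∕ `firstOrderError_le_letter` — the first-order error `E_A` by the MEAN VALUE THEOREM along the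
   background path `s ↦ Q(s)` from a derivative bound `|Q′| ≤ C_B·m·‖B′‖²` ([13] Sect. B input) and the background size
   `m ≤ K_F·M⁶R_kε_k` ([15] Sect. F): `|E_A| ≤ C_BK_F·M⁶R_kε_k‖B′‖²`; **`ineq17_of_steps`** — (1.7) with NO bare letter:
   `Ineq17 Q(1) ‖∂B′‖² ‖B′‖² γ₀ (max (C_BK_F) (2C_DCc² + C²c²)) M R_k ε_k`.
§6 `firstOrderError_le_of_analytic` ∕ `_letter` — the same error from ANALYTICITY of the form in the COMPLEX background parameter
   ([13] (3.37): `U′ = e^{iηA′}`, `|A′| < α₁`; [LF-II] p.359 «valid for 𝔤ᶜ-valued fields») by the SCHWARZ LEMMA (Mathlib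
   `Complex.dist_le_div_mul_dist_of_mapsTo_ball`): holomorphic and bounded by `C_B‖B′‖²` on the disc `|z| < α₁/m` ⇒
   `|Q − Q₀| ≤ (C_BK_F/α₁)·M⁶R_kε_k‖B′‖²` — no derivative computed.
§7 `firstOrderError_le_of_diffMajorant` ∕ `_letter` — the same error from a DIFFERENCE MAJORANT of the background dependence,
   the shape of [13] (3.65) p.403 «G′(U′U) = G′(U) + G′(U)V′(A)G′(U′U) … norms of the second operators … are small» (tree:
   r06's `B9Thm34Ext.remainder_entry1`): `K_D ≤ C_B·m·e^{−δd}` ⇒ `|E_A| ≤ 2C_BCc²·m·‖B′‖²` (= `minimizerError_le` at `R′ = 0`);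
   **`ineq17_of_majorants_only`** — (1.7) from BLOCK MAJORANTS ONLY (the three operators, the two differences, (1.67)).

HONEST SCOPE (located, nothing repaired).  (i) As in the prequel: the identification of the forms with weighted sums of
squares of `∂∘H`, and the three majorants, are DATA ∕ HYPOTHESES of printed shapes ([13] Sect. B ∕ [11] Prop. 2.6 ∕ the
[13] localisation of minimizers to a region) — the cell's k-level (2.140) files (`B6Ineq2140*KLevelV1`, dag-p1's
`B6Ineq2140GradGDiv*`) are where such majorants are proved for `G`; for `∂∘H_k` none is claimed here.  (ii) `E_A`
(*«we expand … up to the first order in A₀. This was discussed in Sect. B [13]»*): at a non-trivial background the form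
is not a weighted sum of squares of one linear map, so §4 keeps it as a LETTER and §5 derives it only from a DERIVATIVE
BOUND along the background path (the [13] Sect. B statement in mean-value form) and [15] Sect. F's `|A₀|, |∇A₀| <
O(1)M⁶R_kε_k` (tree: `B11SectFAssembly.regularity_of_leaves` for the (165)–(169) chain) — both hypotheses of printed shape.  (iii) Unweighted `ℓ²` sizes.  Value = the second of the three printed steps behind
(1.7) as a kernel theorem; with the prequel, r13's letter `hER` is reduced to decay majorants + located geometry;
count-neutral; NOT summit progress.
-/

noncomputable section

open scoped BigOperators
open Finset

namespace Literature.MathematicalPhysics.QuantumFieldTheory.Balaban1983to89.B16Ineq17MinimizerError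

open B6RandomWalk (blockPiece sum_blockPiece)
open B6RandomWalkL2 (l2n l2n_nonneg l2n_zero l2n_sq l2n_add_le l2n_mono blockPiece_sum blockPiece_off)
open B6RandomWalkL2Schur (sum_mul_le_l2n_mul_l2n)
open B16Sect1Wilson (Ineq17)
open B16Ineq17ZetaError (l2n_sq_eq_sum_blockPiece_sq blockSchur ineq17_of_inputs_zeta)

variable {g : B6.Geometry} {X Y : Type} [Fintype X] [Fintype Y] (blkX : X → g.Site) (blkY : Y → g.Site)

/-! ## §1. The global block Schur bound -/

/-- **Global block Schur bound**: hom block-`ℓ²` majorant `K ≥ 0`, row sums `Σ_{y′∈S′}K(y,y′) ≤ A` for every `y` (`A ≥ 0`),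
column sums `Σ_y K(y,y′) ≤ A′` for `y′ ∈ S′`, `supp u ⊂` blocks of `S′` ⇒ `‖Tu‖² ≤ A·A′·‖u‖²` (`blockSchur` over all output
blocks, `‖v‖² = Σ_y‖Δ(y)v‖²`). [cite: Balaban1984PropagatorsII, (2.52) p.232, (2.140)–(2.141) p.247] -/
theorem l2n_apply_sq_le (T : (X → ℝ) →ₗ[ℝ] (Y → ℝ)) {K : g.Site → g.Site → ℝ}
    (hT : ∀ (y y' : g.Site) (u : X → ℝ), (∀ x, blkX x ≠ y' → u x = 0) →
      l2n (blockPiece blkY y (T u)) ≤ K y y' * l2n u)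
    (hK : ∀ a b, 0 ≤ K a b) (S' : Finset g.Site) {A A' : ℝ} (hA : 0 ≤ A)
    (hrow : ∀ y, ∑ y' ∈ S', K y y' ≤ A) (hcol : ∀ y' ∈ S', ∑ y : g.Site, K y y' ≤ A')
    (u : X → ℝ) (hu : ∀ x, blkX x ∉ S' → u x = 0) :
    l2n (T u) ^ 2 ≤ A * A' * l2n u ^ 2 := by
  have h := blockSchur blkX blkY T hT hK Finset.univ S' hA (fun y _ => hrow y) (fun y' hy' => hcol y' hy') u hu
  rwa [← l2n_sq_eq_sum_blockPiece_sq blkY (T u)] at h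

/-- `‖v‖² ≤ (B‖u‖)²`, `B ≥ 0` ⇒ `‖v‖ ≤ B‖u‖`. [folklore] -/
private theorem l2n_le_of_sq_le {v : Y → ℝ} {u : X → ℝ} {B : ℝ} (hB : 0 ≤ B)
    (h : l2n v ^ 2 ≤ (B * l2n u) ^ 2) : l2n v ≤ B * l2n u :=
  (pow_le_pow_iff_left₀ (l2n_nonneg v) (mul_nonneg hB (l2n_nonneg u)) two_ne_zero).mp h

/-- **Global block Schur bound with exponential kernels**: `K ≤ C·e^{−δd}` (`C, δ ≥ 0`, `d ≥ 0`), and ONE constant `c`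
bounding the half-rate row sums `Σ_{y′∈S′}e^{−(δ/2)d(y,y′)}` (all `y`) and column sums `Σ_y e^{−(δ/2)d(y,y′)}` (`y′ ∈ S′`)
((2.61) of [11]; `d` symmetric in print) ⇒ for `supp u ⊂` blocks of `S′`: `‖Tu‖ ≤ C·c·‖u‖`.
[cite: Balaban1984PropagatorsII, (2.61) p.234, (2.140) p.247] -/
theorem l2n_apply_le_of_exp (T : (X → ℝ) →ₗ[ℝ] (Y → ℝ)) {K : g.Site → g.Site → ℝ}
    (hT : ∀ (y y' : g.Site) (u : X → ℝ), (∀ x, blkX x ≠ y' → u x = 0) →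
      l2n (blockPiece blkY y (T u)) ≤ K y y' * l2n u)
    (hK0 : ∀ a b, 0 ≤ K a b) {C δ c : ℝ} (hC : 0 ≤ C) (hδ : 0 ≤ δ) (hc : 0 ≤ c)
    (hd : ∀ a b, 0 ≤ g.dist a b) (hK : ∀ a b, K a b ≤ C * Real.exp (-(δ * g.dist a b))) (S' : Finset g.Site)
    (hrow : ∀ y, ∑ y' ∈ S', Real.exp (-(δ / 2 * g.dist y y')) ≤ c)
    (hcol : ∀ y' ∈ S', ∑ y : g.Site, Real.exp (-(δ / 2 * g.dist y y')) ≤ c)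
    (u : X → ℝ) (hu : ∀ x, blkX x ∉ S' → u x = 0) :
    l2n (T u) ≤ C * c * l2n u := by
  -- full rate ≤ half rate
  have hhalf : ∀ a b, Real.exp (-(δ * g.dist a b)) ≤ Real.exp (-(δ / 2 * g.dist a b)) := by
    intro a b
    exact Real.exp_le_exp.mpr (by nlinarith [mul_nonneg hδ (hd a b)])
  have hrow' : ∀ y, ∑ y' ∈ S', K y y' ≤ C * c := by
    intro y
    calc ∑ y' ∈ S', K y y' ≤ ∑ y' ∈ S', C * Real.exp (-(δ / 2 * g.dist y y')) :=
          Finset.sum_le_sum fun y' _ => (hK y y').trans (mul_le_mul_of_nonneg_left (hhalf y y') hC)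
      _ = C * ∑ y' ∈ S', Real.exp (-(δ / 2 * g.dist y y')) := by rw [Finset.mul_sum]
      _ ≤ C * c := mul_le_mul_of_nonneg_left (hrow y) hC
  have hcol' : ∀ y' ∈ S', ∑ y : g.Site, K y y' ≤ C * c := by
    intro y' hy'
    calc ∑ y : g.Site, K y y' ≤ ∑ y : g.Site, C * Real.exp (-(δ / 2 * g.dist y y')) :=
          Finset.sum_le_sum fun y _ => (hK y y').trans (mul_le_mul_of_nonneg_left (hhalf y y') hC)
      _ = C * ∑ y : g.Site, Real.exp (-(δ / 2 * g.dist y y')) := by rw [Finset.mul_sum]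
      _ ≤ C * c := mul_le_mul_of_nonneg_left (hcol y' hy') hC
  have hCc : 0 ≤ C * c := mul_nonneg hC hc
  have h := l2n_apply_sq_le blkX blkY T hT hK0 S' hCc hrow' hcol' u hu
  exact l2n_le_of_sq_le hCc (by rw [mul_pow]; nlinarith [h])

/-! ## §2. Weighted sums of squares under a perturbation of the operator -/

/-- `‖|f|‖ = ‖f‖` for the `ℓ²` size. [folklore] -/
private theorem l2n_abs (f : Y → ℝ) : l2n (fun x => |f x|) = l2n f :=
  le_antisymm (l2n_mono fun x => by rw [abs_abs]) (l2n_mono fun x => by rw [abs_abs])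

/-- **Perturbation of a weighted sum of squares**: for a weight `|w| ≤ 1` and two lattice functions `a, b`,
`|Σ_x w(x)a(x)² − Σ_x w(x)b(x)²| ≤ ‖a − b‖·(‖a‖ + ‖b‖)` (`a² − b² = (a − b)(a + b)`, Cauchy–Schwarz).
[cite: Balaban1984PropagatorsII, (2.140) p.247 (the norm); Balaban1989LargeFieldII, p.357 («we change the form by a
quadratic form bounded by …»)] -/
theorem abs_weightedSq_sub_le (w : Y → ℝ) (hw : ∀ x, |w x| ≤ 1) (a b : Y → ℝ) :
    |∑ x : Y, w x * a x ^ 2 - ∑ x : Y, w x * b x ^ 2| ≤ l2n (a - b) * (l2n a + l2n b) := by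
  have h1 : ∑ x : Y, w x * a x ^ 2 - ∑ x : Y, w x * b x ^ 2 = ∑ x : Y, w x * ((a x - b x) * (a x + b x)) := by
    rw [← Finset.sum_sub_distrib]
    exact Finset.sum_congr rfl fun x _ => by ring
  rw [h1]
  have h2 : |∑ x : Y, w x * ((a x - b x) * (a x + b x))| ≤ ∑ x : Y, |a x - b x| * |a x + b x| := by
    refine (Finset.abs_sum_le_sum_abs _ _).trans (Finset.sum_le_sum fun x _ => ?_)
    rw [abs_mul, abs_mul]
    calc |w x| * (|a x - b x| * |a x + b x|) ≤ 1 * (|a x - b x| * |a x + b x|) :=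
          mul_le_mul_of_nonneg_right (hw x) (by positivity)
      _ = |a x - b x| * |a x + b x| := one_mul _
  have h3 : ∑ x : Y, |a x - b x| * |a x + b x| ≤ l2n (fun x => |a x - b x|) * l2n (fun x => |a x + b x|) :=
    sum_mul_le_l2n_mul_l2n _ _
  have h4 : l2n (fun x => |a x - b x|) = l2n (a - b) := l2n_abs (a - b)
  have h5 : l2n (fun x => |a x + b x|) = l2n (a + b) := l2n_abs (a + b)
  rw [h4, h5] at h3
  exact h2.trans (h3.trans (mul_le_mul_of_nonneg_left (l2n_add_le a b) (l2n_nonneg _)))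

/-! ## §3. The minimizer-replacement error `E_H` of p. 357 -/

/-- **The minimizer-replacement error** (*«Replacing the minimizer in this form by the kᵗʰ minimizer defined on the whole
lattice … we change the form by a quadratic form bounded by O(exp(−R_k))»*).  Data: `T = ∂∘H_k` and `T_Z = ∂∘H_{1,k,Z}`
with hom block-`ℓ²` majorants `K, K_Z ≤ C·e^{−δd}`; their DIFFERENCE `T_Z − T` with a majorant `K_D` which, for input blocks
`y′ ∈ S′` (the blocks of `Λ`, `R′`-deep inside `Z`), is `≤ C_D·e^{−δR′}·e^{−δd(y,y′)}`; the half-rate row∕column sums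
bounded by `c`; a weight `|w| ≤ 1` (`w = ζ₀`); `supp u ⊂` blocks of `S′` (`u = B′`).  Conclusion:
`|Σ w(T_Zu)² − Σ w(Tu)²| ≤ 2C_D·C·c²·e^{−δR′}·‖u‖²`. [cite: Balaban1989LargeFieldII, p.357 (the sentence before (1.7));
Balaban1984PropagatorsII, (2.61) p.234, (2.140) p.247] -/
theorem minimizerError_le (T TZ : (X → ℝ) →ₗ[ℝ] (Y → ℝ)) {K KZ KD : g.Site → g.Site → ℝ}
    (hT : ∀ (y y' : g.Site) (u : X → ℝ), (∀ x, blkX x ≠ y' → u x = 0) →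
      l2n (blockPiece blkY y (T u)) ≤ K y y' * l2n u)
    (hTZ : ∀ (y y' : g.Site) (u : X → ℝ), (∀ x, blkX x ≠ y' → u x = 0) →
      l2n (blockPiece blkY y (TZ u)) ≤ KZ y y' * l2n u)
    (hTD : ∀ (y y' : g.Site) (u : X → ℝ), (∀ x, blkX x ≠ y' → u x = 0) →
      l2n (blockPiece blkY y ((TZ - T) u)) ≤ KD y y' * l2n u)
    (hK0 : ∀ a b, 0 ≤ K a b) (hKZ0 : ∀ a b, 0 ≤ KZ a b) (hKD0 : ∀ a b, 0 ≤ KD a b)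
    {C CD δ R' c : ℝ} (hC : 0 ≤ C) (hCD : 0 ≤ CD) (hδ : 0 ≤ δ) (hc : 0 ≤ c) (hd : ∀ a b, 0 ≤ g.dist a b)
    (hK : ∀ a b, K a b ≤ C * Real.exp (-(δ * g.dist a b)))
    (hKZ : ∀ a b, KZ a b ≤ C * Real.exp (-(δ * g.dist a b))) (S' : Finset g.Site)
    (hKD : ∀ a, ∀ b ∈ S', KD a b ≤ CD * Real.exp (-(δ * R')) * Real.exp (-(δ * g.dist a b)))
    (hrow : ∀ y, ∑ y' ∈ S', Real.exp (-(δ / 2 * g.dist y y')) ≤ c)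
    (hcol : ∀ y' ∈ S', ∑ y : g.Site, Real.exp (-(δ / 2 * g.dist y y')) ≤ c)
    (w : Y → ℝ) (hw : ∀ x, |w x| ≤ 1) (u : X → ℝ) (hu : ∀ x, blkX x ∉ S' → u x = 0) :
    |∑ x : Y, w x * TZ u x ^ 2 - ∑ x : Y, w x * T u x ^ 2| ≤
      2 * CD * C * c ^ 2 * Real.exp (-(δ * R')) * l2n u ^ 2 := by
  -- the two global bounds `‖Tu‖, ‖T_Zu‖ ≤ Cc‖u‖`
  have hTu : l2n (T u) ≤ C * c * l2n u :=
    l2n_apply_le_of_exp blkX blkY T hT hK0 hC hδ hc hd hK S' hrow hcol u hu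
  have hTZu : l2n (TZ u) ≤ C * c * l2n u :=
    l2n_apply_le_of_exp blkX blkY TZ hTZ hKZ0 hC hδ hc hd hKZ S' hrow hcol u hu
  -- the difference: `‖(T_Z − T)u‖ ≤ C_D e^{−δR′} c‖u‖` (row/column sums only see `y′ ∈ S′`)
  have hE0 : 0 ≤ CD * Real.exp (-(δ * R')) := mul_nonneg hCD (Real.exp_pos _).le
  have hhalf : ∀ a b, Real.exp (-(δ * g.dist a b)) ≤ Real.exp (-(δ / 2 * g.dist a b)) := by
    intro a b
    exact Real.exp_le_exp.mpr (by nlinarith [mul_nonneg hδ (hd a b)])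
  have hrowD : ∀ y, ∑ y' ∈ S', KD y y' ≤ CD * Real.exp (-(δ * R')) * c := by
    intro y
    calc ∑ y' ∈ S', KD y y' ≤ ∑ y' ∈ S', CD * Real.exp (-(δ * R')) * Real.exp (-(δ / 2 * g.dist y y')) :=
          Finset.sum_le_sum fun y' hy' => (hKD y y' hy').trans (mul_le_mul_of_nonneg_left (hhalf y y') hE0)
      _ = CD * Real.exp (-(δ * R')) * ∑ y' ∈ S', Real.exp (-(δ / 2 * g.dist y y')) := by rw [Finset.mul_sum]
      _ ≤ CD * Real.exp (-(δ * R')) * c := mul_le_mul_of_nonneg_left (hrow y) hE0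
  have hcolD : ∀ y' ∈ S', ∑ y : g.Site, KD y y' ≤ CD * Real.exp (-(δ * R')) * c := by
    intro y' hy'
    calc ∑ y : g.Site, KD y y' ≤ ∑ y : g.Site, CD * Real.exp (-(δ * R')) * Real.exp (-(δ / 2 * g.dist y y')) :=
          Finset.sum_le_sum fun y _ => (hKD y y' hy').trans (mul_le_mul_of_nonneg_left (hhalf y y') hE0)
      _ = CD * Real.exp (-(δ * R')) * ∑ y : g.Site, Real.exp (-(δ / 2 * g.dist y y')) := by rw [Finset.mul_sum]
      _ ≤ CD * Real.exp (-(δ * R')) * c := mul_le_mul_of_nonneg_left (hcol y' hy') hE0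
  have hB0 : 0 ≤ CD * Real.exp (-(δ * R')) * c := mul_nonneg hE0 hc
  have hDsq := l2n_apply_sq_le blkX blkY (TZ - T) hTD hKD0 S' hB0 hrowD hcolD u hu
  have hDu : l2n ((TZ - T) u) ≤ CD * Real.exp (-(δ * R')) * c * l2n u :=
    l2n_le_of_sq_le hB0 (by rw [mul_pow]; nlinarith [hDsq])
  have hDu' : l2n (TZ u - T u) ≤ CD * Real.exp (-(δ * R')) * c * l2n u := by
    rw [LinearMap.sub_apply] at hDu; exact hDu
  -- the perturbation identity
  have hpert := abs_weightedSq_sub_le w hw (TZ u) (T u)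
  have hsum : l2n (TZ u) + l2n (T u) ≤ 2 * (C * c * l2n u) := by linarith
  have hu0 : 0 ≤ l2n u := l2n_nonneg u
  calc |∑ x : Y, w x * TZ u x ^ 2 - ∑ x : Y, w x * T u x ^ 2|
      ≤ l2n (TZ u - T u) * (l2n (TZ u) + l2n (T u)) := hpert
    _ ≤ (CD * Real.exp (-(δ * R')) * c * l2n u) * (2 * (C * c * l2n u)) :=
        mul_le_mul hDu' hsum (add_nonneg (l2n_nonneg _) (l2n_nonneg _)) (mul_nonneg hB0 hu0)
    _ = 2 * CD * C * c ^ 2 * Real.exp (-(δ * R')) * l2n u ^ 2 := by ring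

/-- The same in print's letter: with `R_k ≤ δR′`, `|E_H| ≤ 2C_DCc²·e^{−R_k}·‖u‖²` — the shape `|E_R| ≤ C₂e^{−R_k}‖B′‖²`.
[cite: Balaban1989LargeFieldII, p.357, (1.7) p.358] -/
theorem minimizerError_le_exp_Rk (T TZ : (X → ℝ) →ₗ[ℝ] (Y → ℝ)) {K KZ KD : g.Site → g.Site → ℝ}
    (hT : ∀ (y y' : g.Site) (u : X → ℝ), (∀ x, blkX x ≠ y' → u x = 0) →
      l2n (blockPiece blkY y (T u)) ≤ K y y' * l2n u)
    (hTZ : ∀ (y y' : g.Site) (u : X → ℝ), (∀ x, blkX x ≠ y' → u x = 0) →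
      l2n (blockPiece blkY y (TZ u)) ≤ KZ y y' * l2n u)
    (hTD : ∀ (y y' : g.Site) (u : X → ℝ), (∀ x, blkX x ≠ y' → u x = 0) →
      l2n (blockPiece blkY y ((TZ - T) u)) ≤ KD y y' * l2n u)
    (hK0 : ∀ a b, 0 ≤ K a b) (hKZ0 : ∀ a b, 0 ≤ KZ a b) (hKD0 : ∀ a b, 0 ≤ KD a b)
    {C CD δ R' c Rk : ℝ} (hC : 0 ≤ C) (hCD : 0 ≤ CD) (hδ : 0 ≤ δ) (hc : 0 ≤ c) (hd : ∀ a b, 0 ≤ g.dist a b)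
    (hK : ∀ a b, K a b ≤ C * Real.exp (-(δ * g.dist a b)))
    (hKZ : ∀ a b, KZ a b ≤ C * Real.exp (-(δ * g.dist a b))) (S' : Finset g.Site)
    (hKD : ∀ a, ∀ b ∈ S', KD a b ≤ CD * Real.exp (-(δ * R')) * Real.exp (-(δ * g.dist a b)))
    (hrow : ∀ y, ∑ y' ∈ S', Real.exp (-(δ / 2 * g.dist y y')) ≤ c)
    (hcol : ∀ y' ∈ S', ∑ y : g.Site, Real.exp (-(δ / 2 * g.dist y y')) ≤ c) (hRk : Rk ≤ δ * R')
    (w : Y → ℝ) (hw : ∀ x, |w x| ≤ 1) (u : X → ℝ) (hu : ∀ x, blkX x ∉ S' → u x = 0) :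
    |∑ x : Y, w x * TZ u x ^ 2 - ∑ x : Y, w x * T u x ^ 2| ≤ 2 * CD * C * c ^ 2 * Real.exp (-Rk) * l2n u ^ 2 := by
  have h := minimizerError_le blkX blkY T TZ hT hTZ hTD hK0 hKZ0 hKD0 hC hCD hδ hc hd hK hKZ S' hKD hrow hcol w hw u hu
  have hexp : Real.exp (-(δ * R')) ≤ Real.exp (-Rk) := Real.exp_le_exp.mpr (by linarith)
  have hpre : 0 ≤ 2 * CD * C * c ^ 2 := by positivity
  exact h.trans (mul_le_mul_of_nonneg_right (mul_le_mul_of_nonneg_left hexp hpre) (sq_nonneg _))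

/-! ## §4. (1.7) assembled from the decay majorants (the first-order error `E_A` as the only letter) -/

/-- **(1.7) p. 358 FROM DECAY MAJORANTS.**  Data and hypotheses: `T = ∂∘H_k`, `T_Z = ∂∘H_{1,k,Z}`, `T_Z − T` with hom
block-`ℓ²` majorants as in `minimizerError_le` (constants `C`, `C_D`, rate `δ`, depth `R′` of `Λ` in `Z`); the weight
`ζ₀` with `0 ≤ ζ₀ ≤ 1` and `1 − ζ₀` supported over the blocks `S`, separated from the input blocks `S′ ⊇ supp B′` by `R`;
the half-rate row∕column sums `≤ c` (for the `ζ₀`-step also the column sums over `S`, which the full column sums dominate);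
`R_k ≤ δR`, `R_k ≤ δR′` (*«exp(−δ dist) … exp(−R_k)»*); the splitting `Q = Σ_pζ₀(p)(T_ZB′)(p)² + E_A` of the form
`⟨H_{1,k}B′, Δ₁(ζ₀)H_{1,k}B′⟩` with the first-order LETTER `|E_A| ≤ C₁M⁶R_kε_k‖B′‖²` (Sect. F [15] + Sect. B [13]); and
(1.67) [10] as `γ₀‖∂B′‖² ≤ ‖TB′‖²` (`⟨B′, Δ_kB′⟩ = ‖∂H_kB′‖²`, (1.66)).  Conclusion: r13's leaf
`Ineq17 Q ‖∂B′‖² ‖B′‖² γ₀ (max C₁ (2C_DCc² + C²cc)) M R_k ε_k` — (1.7) with `O(1) = max(C₁, 2C_DCc² + C²c²)`.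
BY NAME: `minimizerError_le_exp_Rk` (`E_H`), the prequel's `ineq17_of_inputs_zeta` (`E_ζ` + r13's `ineq17_of_inputs`).
[cite: Balaban1989LargeFieldII, (1.7) pp.357–358; Balaban1984PropagatorsI, (1.65)–(1.67) p.29; Balaban1984PropagatorsII,
(2.61) p.234, (2.140) p.247] -/
theorem ineq17_of_majorants (T TZ : (X → ℝ) →ₗ[ℝ] (Y → ℝ)) {K KZ KD : g.Site → g.Site → ℝ}
    (hT : ∀ (y y' : g.Site) (u : X → ℝ), (∀ x, blkX x ≠ y' → u x = 0) →
      l2n (blockPiece blkY y (T u)) ≤ K y y' * l2n u)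
    (hTZ : ∀ (y y' : g.Site) (u : X → ℝ), (∀ x, blkX x ≠ y' → u x = 0) →
      l2n (blockPiece blkY y (TZ u)) ≤ KZ y y' * l2n u)
    (hTD : ∀ (y y' : g.Site) (u : X → ℝ), (∀ x, blkX x ≠ y' → u x = 0) →
      l2n (blockPiece blkY y ((TZ - T) u)) ≤ KD y y' * l2n u)
    (hK0 : ∀ a b, 0 ≤ K a b) (hKZ0 : ∀ a b, 0 ≤ KZ a b) (hKD0 : ∀ a b, 0 ≤ KD a b)
    {C CD δ R R' c Rk : ℝ} (hC : 0 ≤ C) (hCD : 0 ≤ CD) (hδ : 0 ≤ δ) (hc : 0 ≤ c) (hd : ∀ a b, 0 ≤ g.dist a b)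
    (hK : ∀ a b, K a b ≤ C * Real.exp (-(δ * g.dist a b)))
    (hKZ : ∀ a b, KZ a b ≤ C * Real.exp (-(δ * g.dist a b))) (S S' : Finset g.Site)
    (hKD : ∀ a, ∀ b ∈ S', KD a b ≤ CD * Real.exp (-(δ * R')) * Real.exp (-(δ * g.dist a b)))
    (hsep : ∀ y ∈ S, ∀ y' ∈ S', R ≤ g.dist y y')
    (hrow : ∀ y, ∑ y' ∈ S', Real.exp (-(δ / 2 * g.dist y y')) ≤ c)
    (hcol : ∀ y' ∈ S', ∑ y : g.Site, Real.exp (-(δ / 2 * g.dist y y')) ≤ c)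
    (hRk : Rk ≤ δ * R) (hRk' : Rk ≤ δ * R')
    (ζ : Y → ℝ) (hζ0 : ∀ x, 0 ≤ ζ x) (hζ1 : ∀ x, ζ x ≤ 1) (hζS : ∀ x, ζ x ≠ 1 → blkY x ∈ S)
    (u : X → ℝ) (hu : ∀ x, blkX x ∉ S' → u x = 0)
    {Q EA ndB γ₀ C₁ M εk : ℝ} (hQ : Q = (∑ x : Y, ζ x * TZ u x ^ 2) + EA) (h167 : γ₀ * ndB ≤ ∑ x : Y, T u x ^ 2)
    (hEA : |EA| ≤ C₁ * (M ^ 6 * Rk * εk) * l2n u ^ 2) (hX : 0 ≤ M ^ 6 * Rk * εk) :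
    Ineq17 Q ndB (l2n u ^ 2) γ₀ (max C₁ (2 * CD * C * c ^ 2 + C ^ 2 * c * c)) M Rk εk := by
  classical
  -- the two errors
  set EH : ℝ := ∑ x : Y, ζ x * TZ u x ^ 2 - ∑ x : Y, ζ x * T u x ^ 2 with hEHdef
  have hζabs : ∀ x, |ζ x| ≤ 1 := fun x => by rw [abs_of_nonneg (hζ0 x)]; exact hζ1 x
  have hEH : |EH| ≤ 2 * CD * C * c ^ 2 * Real.exp (-Rk) * l2n u ^ 2 :=
    minimizerError_le_exp_Rk blkX blkY T TZ hT hTZ hTD hK0 hKZ0 hKD0 hC hCD hδ hc hd hK hKZ S' hKD hrow hcol hRk'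
      ζ hζabs u hu
  -- `Σ ζ (Tu)² = Σ (Tu)² − Σ (1 − ζ)(Tu)²`
  have hsplit : ∑ x : Y, ζ x * T u x ^ 2 = ∑ x : Y, T u x ^ 2 + -(∑ x : Y, (1 - ζ x) * T u x ^ 2) := by
    rw [← sub_eq_add_neg, ← Finset.sum_sub_distrib]
    exact Finset.sum_congr rfl fun x _ => by ring
  have hQ' : Q = (∑ x : Y, T u x ^ 2) + EA + (EH + -(∑ x : Y, (1 - ζ x) * T u x ^ 2)) := by
    rw [hQ, hEHdef, hsplit]; ring
  -- the `ζ₀ → 1` hypotheses for `w = 1 − ζ₀`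
  have hw0 : ∀ x, 0 ≤ 1 - ζ x := fun x => by linarith [hζ1 x]
  have hw1 : ∀ x, 1 - ζ x ≤ 1 := fun x => by linarith [hζ0 x]
  have hwS : ∀ x, 1 - ζ x ≠ 0 → blkY x ∈ S := fun x hx => hζS x (fun h => hx (by rw [h]; ring))
  have hcolS : ∀ y' ∈ S', ∑ y ∈ S, Real.exp (-(δ / 2 * g.dist y y')) ≤ c := fun y' hy' =>
    (Finset.sum_le_sum_of_subset_of_nonneg (Finset.subset_univ S) fun y _ _ => (Real.exp_pos _).le).trans (hcol y' hy')
  exact ineq17_of_inputs_zeta blkX blkY T hT hK0 hC hδ hc hc hK S S' hsep (fun y _ => hrow y) hcolS (fun x => 1 - ζ x)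
    hw0 hw1 hwS u hu hRk hQ' h167 hEA hEH hX

/-! ## §5. The first-order error `E_A` by the mean value theorem, and (1.7) with no bare letter -/

/-- **The first-order error of the expansion in `A₀`** (*«we expand the expressions defining the quadratic form with
respect to A₀, up to the first order in A₀. This was discussed in Sect. B [13]. The leading term in the expansion is the
quadratic form with the background field identically equal to 1»*), mean-value form: along the background path
`s ↦ Q(s)` (the form at the background `exp(isξA₀)`, `Q(1)` = the form, `Q(0)` = the background-`1` form) with derivative
`Q′(s)`, `|Q′(s)| ≤ C_B·m·‖B′‖²` on `[0,1]` (the [13] Sect. B input: analytic dependence of the operators on the background,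
`m` = the size of `A₀`), one has `|Q(1) − Q(0)| ≤ C_B·m·‖B′‖²`. [cite: Balaban1989LargeFieldII, p.357 (the two sentences
before «Replacing the minimizer»)] -/
theorem firstOrderError_le {Qpath Q' : ℝ → ℝ} {CB m nB : ℝ}
    (hder : ∀ s ∈ Set.Icc (0 : ℝ) 1, HasDerivAt Qpath (Q' s) s)
    (hbound : ∀ s ∈ Set.Icc (0 : ℝ) 1, |Q' s| ≤ CB * m * nB) :
    |Qpath 1 - Qpath 0| ≤ CB * m * nB := by
  have h := norm_image_sub_le_of_norm_deriv_le_segment' (f := Qpath) (a := 0) (b := 1)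
    (fun s hs => (hder s hs).hasDerivWithinAt) (fun s hs => by
      rw [Real.norm_eq_abs]; exact hbound s (Set.Ico_subset_Icc_self hs)) 1 (by norm_num)
  rw [Real.norm_eq_abs, sub_zero, mul_one] at h
  exact h

/-- The same in print's letter: with Sect. F [15]'s size of the background, `m ≤ K_F·M⁶R_kε_k` (*«|A₀|, |∇^ηA₀| <
O(1)M⁶R_kε_k»*), `C_B ≥ 0`, `‖B′‖² ≥ 0`: `|E_A| ≤ (C_B·K_F)·M⁶R_kε_k·‖B′‖²` — the shape of the letter `hEA` of
`B16Ineq17Assembly.ineq17_of_inputs`. [cite: Balaban1989LargeFieldII, p.357; Balaban1985Variational, (165)–(167) p.304] -/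
theorem firstOrderError_le_letter {Qpath Q' : ℝ → ℝ} {CB m nB KF M Rk εk : ℝ}
    (hder : ∀ s ∈ Set.Icc (0 : ℝ) 1, HasDerivAt Qpath (Q' s) s)
    (hbound : ∀ s ∈ Set.Icc (0 : ℝ) 1, |Q' s| ≤ CB * m * nB) (hCB : 0 ≤ CB) (hnB : 0 ≤ nB)
    (hm : m ≤ KF * (M ^ 6 * Rk * εk)) :
    |Qpath 1 - Qpath 0| ≤ CB * KF * (M ^ 6 * Rk * εk) * nB := by
  refine (firstOrderError_le hder hbound).trans ?_
  have h := mul_le_mul_of_nonneg_left hm hCB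
  calc CB * m * nB ≤ CB * (KF * (M ^ 6 * Rk * εk)) * nB := mul_le_mul_of_nonneg_right h hnB
    _ = CB * KF * (M ^ 6 * Rk * εk) * nB := by ring

/-- **(1.7) p. 358 FROM ITS THREE PRINTED STEPS, NO BARE LETTER.**  `ineq17_of_majorants` with the first-order error supplied by
`firstOrderError_le_letter`: the form is `Q = Q(1)` of a background path with `Q(0) = Σ_pζ₀(p)(T_ZB′)(p)²` (the
background-`1` form of the region minimizer), derivative bound `|Q′| ≤ C_B·m·‖B′‖²` on `[0,1]` ([13] Sect. B) and background
size `m ≤ K_F·M⁶R_kε_k` ([15] Sect. F); then the two replacement errors from the decay majorants and (1.67) [10] give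
`Ineq17 Q ‖∂B′‖² ‖B′‖² γ₀ (max (C_BK_F) (2C_DCc² + C²c²)) M R_k ε_k`.
[cite: Balaban1989LargeFieldII, (1.7) pp.357–358; Balaban1984PropagatorsI, (1.67) p.29; Balaban1985Variational,
(165)–(167) p.304] -/
theorem ineq17_of_steps (T TZ : (X → ℝ) →ₗ[ℝ] (Y → ℝ)) {K KZ KD : g.Site → g.Site → ℝ}
    (hT : ∀ (y y' : g.Site) (u : X → ℝ), (∀ x, blkX x ≠ y' → u x = 0) →
      l2n (blockPiece blkY y (T u)) ≤ K y y' * l2n u)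
    (hTZ : ∀ (y y' : g.Site) (u : X → ℝ), (∀ x, blkX x ≠ y' → u x = 0) →
      l2n (blockPiece blkY y (TZ u)) ≤ KZ y y' * l2n u)
    (hTD : ∀ (y y' : g.Site) (u : X → ℝ), (∀ x, blkX x ≠ y' → u x = 0) →
      l2n (blockPiece blkY y ((TZ - T) u)) ≤ KD y y' * l2n u)
    (hK0 : ∀ a b, 0 ≤ K a b) (hKZ0 : ∀ a b, 0 ≤ KZ a b) (hKD0 : ∀ a b, 0 ≤ KD a b)
    {C CD δ R R' c Rk : ℝ} (hC : 0 ≤ C) (hCD : 0 ≤ CD) (hδ : 0 ≤ δ) (hc : 0 ≤ c) (hd : ∀ a b, 0 ≤ g.dist a b)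
    (hK : ∀ a b, K a b ≤ C * Real.exp (-(δ * g.dist a b)))
    (hKZ : ∀ a b, KZ a b ≤ C * Real.exp (-(δ * g.dist a b))) (S S' : Finset g.Site)
    (hKD : ∀ a, ∀ b ∈ S', KD a b ≤ CD * Real.exp (-(δ * R')) * Real.exp (-(δ * g.dist a b)))
    (hsep : ∀ y ∈ S, ∀ y' ∈ S', R ≤ g.dist y y')
    (hrow : ∀ y, ∑ y' ∈ S', Real.exp (-(δ / 2 * g.dist y y')) ≤ c)
    (hcol : ∀ y' ∈ S', ∑ y : g.Site, Real.exp (-(δ / 2 * g.dist y y')) ≤ c)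
    (hRk : Rk ≤ δ * R) (hRk' : Rk ≤ δ * R')
    (ζ : Y → ℝ) (hζ0 : ∀ x, 0 ≤ ζ x) (hζ1 : ∀ x, ζ x ≤ 1) (hζS : ∀ x, ζ x ≠ 1 → blkY x ∈ S)
    (u : X → ℝ) (hu : ∀ x, blkX x ∉ S' → u x = 0)
    {Qpath Q' : ℝ → ℝ} {CB m KF ndB γ₀ M εk : ℝ}
    (hder : ∀ s ∈ Set.Icc (0 : ℝ) 1, HasDerivAt Qpath (Q' s) s)
    (hbound : ∀ s ∈ Set.Icc (0 : ℝ) 1, |Q' s| ≤ CB * m * l2n u ^ 2) (hCB : 0 ≤ CB)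
    (hm : m ≤ KF * (M ^ 6 * Rk * εk)) (hQ0 : Qpath 0 = ∑ x : Y, ζ x * TZ u x ^ 2)
    (h167 : γ₀ * ndB ≤ ∑ x : Y, T u x ^ 2) (hX : 0 ≤ M ^ 6 * Rk * εk) :
    Ineq17 (Qpath 1) ndB (l2n u ^ 2) γ₀ (max (CB * KF) (2 * CD * C * c ^ 2 + C ^ 2 * c * c)) M Rk εk := by
  have hEA : |Qpath 1 - Qpath 0| ≤ CB * KF * (M ^ 6 * Rk * εk) * l2n u ^ 2 :=
    firstOrderError_le_letter hder hbound hCB (sq_nonneg _) hm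
  have hQ : Qpath 1 = (∑ x : Y, ζ x * TZ u x ^ 2) + (Qpath 1 - Qpath 0) := by rw [hQ0]; ring
  exact ineq17_of_majorants blkX blkY T TZ hT hTZ hTD hK0 hKZ0 hKD0 hC hCD hδ hc hd hK hKZ S S' hKD hsep hrow hcol hRk hRk'
    ζ hζ0 hζ1 hζS u hu hQ h167 hEA hX

/-! ## §6. The first-order error from ANALYTICITY in the complex background (Schwarz lemma) -/

/-- **`E_A` from analyticity in the complex background parameter.**  [13] Sect. B ∕ Thm 3.4 give the operators, hence
the form, as ANALYTIC functions of a complex background `U′U`, `U′ = e^{iηA′}`, `|A′| < α₁` ((3.37)), with the bounds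
holding on the complex domain ([LF-II] p.359 *«The above equations, bounds and statements are valid for 𝔤ᶜ-valued
fields»*).  Along the complex line `z ↦ e^{izξA₀}` the form is a function `Qc` holomorphic on the disc `|z| < ρ₀`,
`ρ₀ = α₁/m` (`m` the size of `A₀`), and bounded there: `‖Qc z − Qc 0‖ ≤ B`.  If `ρ₀ > 1` (small background, `m < α₁`)
the SCHWARZ LEMMA gives `‖Qc 1 − Qc 0‖ ≤ B/ρ₀` — the first-order error with NO derivative computed.
[cite: Balaban1989LargeFieldII, p.357 («up to the first order in A₀ … Sect. B [13]»), p.359; Balaban1985BackgroundPropagators,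
(3.37)–(3.38) p.396] -/
theorem firstOrderError_le_of_analytic {Qc : ℂ → ℂ} {ρ₀ B : ℝ} (hρ : 1 < ρ₀)
    (hd : DifferentiableOn ℂ Qc (Metric.ball 0 ρ₀)) (hB : ∀ z ∈ Metric.ball (0 : ℂ) ρ₀, ‖Qc z - Qc 0‖ ≤ B) :
    ‖Qc 1 - Qc 0‖ ≤ B / ρ₀ := by
  have h1 : (1 : ℂ) ∈ Metric.ball (0 : ℂ) ρ₀ := by
    rw [Metric.mem_ball, dist_zero_right, norm_one]; exact hρ
  have hmaps : Set.MapsTo Qc (Metric.ball 0 ρ₀) (Metric.closedBall (Qc 0) B) := by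
    intro z hz
    rw [Metric.mem_closedBall, dist_eq_norm]
    exact hB z hz
  have h := Complex.dist_le_div_mul_dist_of_mapsTo_ball hd hmaps h1
  rw [dist_eq_norm, dist_zero_right, norm_one, mul_one] at h
  exact h

/-- The same in print's letter: the REAL form `Q = Qc 1` at the actual background and `Q₀ = Qc 0` at the background `1`,
the disc radius `ρ₀ = α₁/m` with `0 < m < α₁`, the bound `B = C_B·‖B′‖²` on the disc, and [15] Sect. F's size
`m ≤ K_F·M⁶R_kε_k` with `2m ≤ α₁` (so `1/ρ₀ = m/α₁` and no blow-up): `|Q − Q₀| ≤ (C_B·K_F/α₁)·M⁶R_kε_k·‖B′‖²` — the shape of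
the letter `hEA` of `B16Ineq17Assembly.ineq17_of_inputs` ∕ `ineq17_of_majorants`.
[cite: Balaban1989LargeFieldII, p.357; Balaban1985Variational, (165)–(167) p.304; Balaban1985BackgroundPropagators, (3.37) p.396] -/
theorem firstOrderError_le_of_analytic_letter {Qc : ℂ → ℂ} {Q Q₀ m α₁ CB nB KF M Rk εk : ℝ}
    (hQ : (Q : ℂ) = Qc 1) (hQ₀ : (Q₀ : ℂ) = Qc 0) (hm : 0 < m) (hmα : m < α₁)
    (hd : DifferentiableOn ℂ Qc (Metric.ball 0 (α₁ / m)))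
    (hB : ∀ z ∈ Metric.ball (0 : ℂ) (α₁ / m), ‖Qc z - Qc 0‖ ≤ CB * nB) (hCB : 0 ≤ CB) (hnB : 0 ≤ nB)
    (hα₁ : 0 < α₁) (hmK : m ≤ KF * (M ^ 6 * Rk * εk)) :
    |Q - Q₀| ≤ CB * KF / α₁ * (M ^ 6 * Rk * εk) * nB := by
  have hρ : 1 < α₁ / m := (one_lt_div hm).mpr hmα
  have h := firstOrderError_le_of_analytic hρ hd hB
  have habs : |Q - Q₀| = ‖Qc 1 - Qc 0‖ := by
    rw [← hQ, ← hQ₀, ← Complex.ofReal_sub, Complex.norm_real, Real.norm_eq_abs]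
  rw [habs]
  refine h.trans ?_
  rw [div_div_eq_mul_div]
  -- `CB·nB·m/α₁ ≤ CB·KF/α₁·(M⁶R_kε_k)·nB`
  have h1 : CB * nB * m ≤ CB * nB * (KF * (M ^ 6 * Rk * εk)) :=
    mul_le_mul_of_nonneg_left hmK (mul_nonneg hCB hnB)
  have h2 : CB * nB * m / α₁ ≤ CB * nB * (KF * (M ^ 6 * Rk * εk)) / α₁ :=
    div_le_div_of_nonneg_right h1 hα₁.le
  calc CB * nB * m / α₁ ≤ CB * nB * (KF * (M ^ 6 * Rk * εk)) / α₁ := h2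
    _ = CB * KF / α₁ * (M ^ 6 * Rk * εk) * nB := by ring

/-! ## §7. The first-order error from a DIFFERENCE MAJORANT of the background dependence ([13] (3.65)) -/

/-- **`E_A` from the remainder of [13] (3.65).**  [Balaban1985BackgroundPropagators] p. 403: *«G′(U′U) = G′(U) +
G′(U)V′(A)G′(U′U) … (3.65), and norms of the second operators on the right-hand sides are small»* — the propagators at
the backgrounds `U′U` (`U′ = e^{iηA}`, `|A| < α₁`) and `U` DIFFER by an operator whose block majorant carries the factor
`O(1)B₀α₁` (tree: r06's `B9Thm34Ext.remainder_entry1`).  Hence for the linearised curvature `T₁` at the background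
`e^{iξA₀}` (after the gauge transformation of [15] Sect. F) and `T₀` at the background `1`: block-`ℓ²` majorants
`K₁, K₀ ≤ C·e^{−δd}` and a DIFFERENCE majorant `K_D ≤ (C_B·m)·e^{−δd}` on the `Λ`-inputs, `m` the size of `A₀`.  Then, by
the same global block Schur bound and perturbation identity as `minimizerError_le` (at `R′ = 0`):
`|Σ_p ζ₀(p)(T₁B′)(p)² − Σ_p ζ₀(p)(T₀B′)(p)²| ≤ 2·(C_B m)·C·c²·‖B′‖²`. [cite: Balaban1989LargeFieldII, p.357 («we expand …
with respect to A₀, up to the first order in A₀. This was discussed in Sect. B [13]»); Balaban1985BackgroundPropagators,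
(3.65) p.403] -/
theorem firstOrderError_le_of_diffMajorant (T₀ T₁ : (X → ℝ) →ₗ[ℝ] (Y → ℝ)) {K₀ K₁ KD : g.Site → g.Site → ℝ}
    (hT₀ : ∀ (y y' : g.Site) (u : X → ℝ), (∀ x, blkX x ≠ y' → u x = 0) →
      l2n (blockPiece blkY y (T₀ u)) ≤ K₀ y y' * l2n u)
    (hT₁ : ∀ (y y' : g.Site) (u : X → ℝ), (∀ x, blkX x ≠ y' → u x = 0) →
      l2n (blockPiece blkY y (T₁ u)) ≤ K₁ y y' * l2n u)
    (hTD : ∀ (y y' : g.Site) (u : X → ℝ), (∀ x, blkX x ≠ y' → u x = 0) →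
      l2n (blockPiece blkY y ((T₁ - T₀) u)) ≤ KD y y' * l2n u)
    (hK0 : ∀ a b, 0 ≤ K₀ a b) (hK1 : ∀ a b, 0 ≤ K₁ a b) (hKD0 : ∀ a b, 0 ≤ KD a b)
    {C CB m δ c : ℝ} (hC : 0 ≤ C) (hCB : 0 ≤ CB) (hm : 0 ≤ m) (hδ : 0 ≤ δ) (hc : 0 ≤ c)
    (hd : ∀ a b, 0 ≤ g.dist a b)
    (hK₀ : ∀ a b, K₀ a b ≤ C * Real.exp (-(δ * g.dist a b)))
    (hK₁ : ∀ a b, K₁ a b ≤ C * Real.exp (-(δ * g.dist a b))) (S' : Finset g.Site)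
    (hKD : ∀ a, ∀ b ∈ S', KD a b ≤ CB * m * Real.exp (-(δ * g.dist a b)))
    (hrow : ∀ y, ∑ y' ∈ S', Real.exp (-(δ / 2 * g.dist y y')) ≤ c)
    (hcol : ∀ y' ∈ S', ∑ y : g.Site, Real.exp (-(δ / 2 * g.dist y y')) ≤ c)
    (w : Y → ℝ) (hw : ∀ x, |w x| ≤ 1) (u : X → ℝ) (hu : ∀ x, blkX x ∉ S' → u x = 0) :
    |∑ x : Y, w x * T₁ u x ^ 2 - ∑ x : Y, w x * T₀ u x ^ 2| ≤ 2 * (CB * m) * C * c ^ 2 * l2n u ^ 2 := by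
  have hKD' : ∀ a, ∀ b ∈ S', KD a b ≤ CB * m * Real.exp (-(δ * 0)) * Real.exp (-(δ * g.dist a b)) := by
    intro a b hb; simpa using hKD a b hb
  have h := minimizerError_le blkX blkY T₀ T₁ hT₀ hT₁ hTD hK0 hK1 hKD0 hC (mul_nonneg hCB hm) hδ hc hd hK₀ hK₁ S'
    hKD' hrow hcol w hw u hu
  simpa using h

/-- The same in print's letter: with [15] Sect. F's `m ≤ K_F·M⁶R_kε_k`: `|E_A| ≤ (2C_BCc²·K_F)·M⁶R_kε_k·‖B′‖²` — the shape
of the letter `hEA`. [cite: Balaban1989LargeFieldII, p.357; Balaban1985Variational, (165)–(167) p.304;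
Balaban1985BackgroundPropagators, (3.65) p.403] -/
theorem firstOrderError_le_of_diffMajorant_letter (T₀ T₁ : (X → ℝ) →ₗ[ℝ] (Y → ℝ)) {K₀ K₁ KD : g.Site → g.Site → ℝ}
    (hT₀ : ∀ (y y' : g.Site) (u : X → ℝ), (∀ x, blkX x ≠ y' → u x = 0) →
      l2n (blockPiece blkY y (T₀ u)) ≤ K₀ y y' * l2n u)
    (hT₁ : ∀ (y y' : g.Site) (u : X → ℝ), (∀ x, blkX x ≠ y' → u x = 0) →
      l2n (blockPiece blkY y (T₁ u)) ≤ K₁ y y' * l2n u)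
    (hTD : ∀ (y y' : g.Site) (u : X → ℝ), (∀ x, blkX x ≠ y' → u x = 0) →
      l2n (blockPiece blkY y ((T₁ - T₀) u)) ≤ KD y y' * l2n u)
    (hK0 : ∀ a b, 0 ≤ K₀ a b) (hK1 : ∀ a b, 0 ≤ K₁ a b) (hKD0 : ∀ a b, 0 ≤ KD a b)
    {C CB m δ c KF M Rk εk : ℝ} (hC : 0 ≤ C) (hCB : 0 ≤ CB) (hm : 0 ≤ m) (hδ : 0 ≤ δ) (hc : 0 ≤ c)
    (hd : ∀ a b, 0 ≤ g.dist a b)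
    (hK₀ : ∀ a b, K₀ a b ≤ C * Real.exp (-(δ * g.dist a b)))
    (hK₁ : ∀ a b, K₁ a b ≤ C * Real.exp (-(δ * g.dist a b))) (S' : Finset g.Site)
    (hKD : ∀ a, ∀ b ∈ S', KD a b ≤ CB * m * Real.exp (-(δ * g.dist a b)))
    (hrow : ∀ y, ∑ y' ∈ S', Real.exp (-(δ / 2 * g.dist y y')) ≤ c)
    (hcol : ∀ y' ∈ S', ∑ y : g.Site, Real.exp (-(δ / 2 * g.dist y y')) ≤ c)
    (w : Y → ℝ) (hw : ∀ x, |w x| ≤ 1) (u : X → ℝ) (hu : ∀ x, blkX x ∉ S' → u x = 0)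
    (hmK : m ≤ KF * (M ^ 6 * Rk * εk)) :
    |∑ x : Y, w x * T₁ u x ^ 2 - ∑ x : Y, w x * T₀ u x ^ 2| ≤ 2 * CB * C * c ^ 2 * KF * (M ^ 6 * Rk * εk) * l2n u ^ 2 := by
  have h := firstOrderError_le_of_diffMajorant blkX blkY T₀ T₁ hT₀ hT₁ hTD hK0 hK1 hKD0 hC hCB hm hδ hc hd hK₀ hK₁ S'
    hKD hrow hcol w hw u hu
  have hpre : 0 ≤ 2 * CB * C * c ^ 2 * l2n u ^ 2 := by positivity
  calc |∑ x : Y, w x * T₁ u x ^ 2 - ∑ x : Y, w x * T₀ u x ^ 2| ≤ 2 * (CB * m) * C * c ^ 2 * l2n u ^ 2 := h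
    _ = (2 * CB * C * c ^ 2 * l2n u ^ 2) * m := by ring
    _ ≤ (2 * CB * C * c ^ 2 * l2n u ^ 2) * (KF * (M ^ 6 * Rk * εk)) := mul_le_mul_of_nonneg_left hmK hpre
    _ = 2 * CB * C * c ^ 2 * KF * (M ^ 6 * Rk * εk) * l2n u ^ 2 := by ring

/-- **(1.7) FROM BLOCK MAJORANTS ONLY.**  All three printed steps behind (1.7) reduced to DECAY MAJORANTS of the
linearised curvature operators: `T₁` (region minimizer at the small background `A₀`), `T_Z = T₀` (region minimizer at
background `1`), `T` (whole-lattice k-th minimizer at background `1`), the two DIFFERENCES `T₁ − T_Z` (majorant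
`≤ C_B·m·e^{−δd}` on `Λ`-inputs: [13] (3.65)) and `T_Z − T` (majorant `≤ C_D·e^{−δR′}e^{−δd}`: [13] localisation), the
weight `ζ₀`, the half-rate (2.61) sums, the geometry `R_k ≤ δR`, `R_k ≤ δR′`, [15] Sect. F's `m ≤ K_F·M⁶R_kε_k`, and
(1.67) [10] as `γ₀‖∂B′‖² ≤ ‖TB′‖²`: r13's leaf `Ineq17 (Σ_pζ₀(p)(T₁B′)(p)²) ‖∂B′‖² ‖B′‖² γ₀ (max (2C_BCc²K_F) (2C_DCc² + C²c²))
M R_k ε_k`. [cite: Balaban1989LargeFieldII, (1.7) pp.357–358; Balaban1985BackgroundPropagators, (3.65) p.403;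
Balaban1984PropagatorsI, (1.67) p.29; Balaban1985Variational, (165)–(167) p.304] -/
theorem ineq17_of_majorants_only (T TZ T₁ : (X → ℝ) →ₗ[ℝ] (Y → ℝ)) {K KZ K₁ KD KA : g.Site → g.Site → ℝ}
    (hT : ∀ (y y' : g.Site) (u : X → ℝ), (∀ x, blkX x ≠ y' → u x = 0) →
      l2n (blockPiece blkY y (T u)) ≤ K y y' * l2n u)
    (hTZ : ∀ (y y' : g.Site) (u : X → ℝ), (∀ x, blkX x ≠ y' → u x = 0) →
      l2n (blockPiece blkY y (TZ u)) ≤ KZ y y' * l2n u)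
    (hT₁ : ∀ (y y' : g.Site) (u : X → ℝ), (∀ x, blkX x ≠ y' → u x = 0) →
      l2n (blockPiece blkY y (T₁ u)) ≤ K₁ y y' * l2n u)
    (hTD : ∀ (y y' : g.Site) (u : X → ℝ), (∀ x, blkX x ≠ y' → u x = 0) →
      l2n (blockPiece blkY y ((TZ - T) u)) ≤ KD y y' * l2n u)
    (hTA : ∀ (y y' : g.Site) (u : X → ℝ), (∀ x, blkX x ≠ y' → u x = 0) →
      l2n (blockPiece blkY y ((T₁ - TZ) u)) ≤ KA y y' * l2n u)
    (hK0 : ∀ a b, 0 ≤ K a b) (hKZ0 : ∀ a b, 0 ≤ KZ a b) (hK10 : ∀ a b, 0 ≤ K₁ a b) (hKD0 : ∀ a b, 0 ≤ KD a b)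
    (hKA0 : ∀ a b, 0 ≤ KA a b)
    {C CD CB m δ R R' c Rk KF M εk : ℝ} (hC : 0 ≤ C) (hCD : 0 ≤ CD) (hCB : 0 ≤ CB) (hm : 0 ≤ m) (hδ : 0 ≤ δ)
    (hc : 0 ≤ c) (hd : ∀ a b, 0 ≤ g.dist a b)
    (hK : ∀ a b, K a b ≤ C * Real.exp (-(δ * g.dist a b)))
    (hKZ : ∀ a b, KZ a b ≤ C * Real.exp (-(δ * g.dist a b)))
    (hK₁ : ∀ a b, K₁ a b ≤ C * Real.exp (-(δ * g.dist a b))) (S S' : Finset g.Site)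
    (hKD : ∀ a, ∀ b ∈ S', KD a b ≤ CD * Real.exp (-(δ * R')) * Real.exp (-(δ * g.dist a b)))
    (hKA : ∀ a, ∀ b ∈ S', KA a b ≤ CB * m * Real.exp (-(δ * g.dist a b)))
    (hsep : ∀ y ∈ S, ∀ y' ∈ S', R ≤ g.dist y y')
    (hrow : ∀ y, ∑ y' ∈ S', Real.exp (-(δ / 2 * g.dist y y')) ≤ c)
    (hcol : ∀ y' ∈ S', ∑ y : g.Site, Real.exp (-(δ / 2 * g.dist y y')) ≤ c)
    (hRk : Rk ≤ δ * R) (hRk' : Rk ≤ δ * R') (hmK : m ≤ KF * (M ^ 6 * Rk * εk)) (hX : 0 ≤ M ^ 6 * Rk * εk)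
    (ζ : Y → ℝ) (hζ0 : ∀ x, 0 ≤ ζ x) (hζ1 : ∀ x, ζ x ≤ 1) (hζS : ∀ x, ζ x ≠ 1 → blkY x ∈ S)
    (u : X → ℝ) (hu : ∀ x, blkX x ∉ S' → u x = 0) {ndB γ₀ : ℝ} (h167 : γ₀ * ndB ≤ ∑ x : Y, T u x ^ 2) :
    Ineq17 (∑ x : Y, ζ x * T₁ u x ^ 2) ndB (l2n u ^ 2) γ₀
      (max (2 * CB * C * c ^ 2 * KF) (2 * CD * C * c ^ 2 + C ^ 2 * c * c)) M Rk εk := by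
  have hζabs : ∀ x, |ζ x| ≤ 1 := fun x => by rw [abs_of_nonneg (hζ0 x)]; exact hζ1 x
  have hEA := firstOrderError_le_of_diffMajorant_letter blkX blkY TZ T₁ hTZ hT₁ hTA hKZ0 hK10 hKA0 hC hCB hm hδ hc hd hKZ
    hK₁ S' hKA hrow hcol ζ hζabs u hu hmK
  have hEA' : |∑ x : Y, ζ x * T₁ u x ^ 2 - ∑ x : Y, ζ x * TZ u x ^ 2| ≤
      2 * CB * C * c ^ 2 * KF * (M ^ 6 * Rk * εk) * l2n u ^ 2 := hEA
  have hQ : (∑ x : Y, ζ x * T₁ u x ^ 2) =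
      (∑ x : Y, ζ x * TZ u x ^ 2) + (∑ x : Y, ζ x * T₁ u x ^ 2 - ∑ x : Y, ζ x * TZ u x ^ 2) := by ring
  exact ineq17_of_majorants blkX blkY T TZ hT hTZ hTD hK0 hKZ0 hKD0 hC hCD hδ hc hd hK hKZ S S' hKD hsep hrow hcol hRk hRk'
    ζ hζ0 hζ1 hζS u hu hQ h167 hEA' hX

end Literature.MathematicalPhysics.QuantumFieldTheory.Balaban1983to89.B16Ineq17MinimizerError

end
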